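import Summits.SmoothPoincare4.SmoothPoincare4.Theses.EntropyRung
import Summits.SmoothPoincare4.SmoothPoincare4.Theorems.EntropyRungSubcylindricalExistenceEntropyLocalisation
import Summits.SmoothPoincare4.SmoothPoincare4.Theorems.EntropyRungSubcylindricalExistenceConformalRealisation
import Summits.SmoothPoincare4.SmoothPoincare4.Theorems.EntropyRungSubcylindricalExistenceGluingEnergyBound
import Literature.Geometry.Lorentzian.ConformalChangeFour
import Literature.Geometry.Lorentzian.ChartLaplacian
import Literature.Geometry.Riemannian.BakryEmeryHeatFlow
import Literature.Geometry.Riemannian.PerelmanEntropyCutoff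
import HarnessLib

/-!
# Reading the realised metric `ψ² g` on `g`, and normalising a localised piece
# (line `green-blowup-conformal-entropy`, crux `EntropyRung.SubcylindricalExistence`,
# stmt-SmoothPoincare4-10871; helpers for Stub D, used by `…GluingLocalisation.lean`)

The small-scale step of the lead's assembly `stub_conformalGluing` (reshape R-c2). On the fixed
background `(M, g, dV_g)` consider the `ψ`-weighted `w²`-form of Perelman's functional of the
conformal metric `ψ² g`,
`E(w) = ∫ [τ(r w² + 4ψ⁻²|∇w|²_g) − w² log w² − 4w²] c ψ⁴ dV_g`, `c = (4πτ)⁻²`, `r = ψ⁻³ L_g ψ ≥ 0`.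
Given a smooth partition `χ₁² + χ₂² = 1` whose pieces are supported in regions `U₁`, `U₂` on which
the clause holds (at the scale `τ`) at levels `L₁`, `L₂`, a Yamabe–Sobolev inequality for the weight
`ψ` with constant `Y`, and a bound `√(∫ (|∇χ₁|² + |∇χ₂|²)² dV_g) ≤ Θ`, every normalised smooth `w`
satisfies `E(w) ≥ L` as soon as `L < 0` and `L + (4/Y) C_Y⁺ Θ ≤ min(L₁, L₂)`,
`C_Y = 3(4 + 2 log(4π) − 2 log Y) + 6 log 6 − 6`:
* if `E(w) ≥ 0 > L` there is nothing to prove;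
* otherwise the IMS localisation inequality (H1 `wEntropy_localisation_two`, p102169, applied to the
  realised metric `ψ² g` and read back on `g` by the conformal laws `R' = ψ⁻³L_gψ`,
  `|∇·|²' = ψ⁻²|∇·|²`, `dV' = ψ⁴ dV`) gives `E(w) ≥ Σᵢ (E(χᵢw) + mᵢ log mᵢ) − 4τ ∫ c w² ψ² Σ|∇χᵢ|²_g`,
  the pieces satisfy `E(χᵢ w) + mᵢ log mᵢ = mᵢ E(ŵᵢ) ≥ mᵢ Lᵢ` (`ŵᵢ = χᵢw/√mᵢ` normalised; for
  `mᵢ = 0` the left side is `≥ 0` directly), `m₁ + m₂ = 1`, and the cost is `≤ (4/Y) C_Y⁺ Θ` by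
  `gluingCutoffCost` (p112238) since `E(w) < 0`.
Everything is proved; no definitions, no named facts.
-/

noncomputable section

set_option linter.dupNamespace false

open scoped Manifold ContDiff Topology ENNReal
open Set Filter MeasureTheory
open Literature.Geometry.Lorentzian

namespace Summit.SmoothPoincare4.SmoothPoincare4.Theorems

namespace GluingLocalisation

variable {M : Type} [TopologicalSpace M] [T2Space M] [SecondCountableTopology M]
  [ChartedSpace (EuclideanSpace ℝ (Fin 4)) M] [IsManifold (𝓡 4) ∞ M] [CompactSpace M]
  [T3Space M] [MeasurableSpace M] [BorelSpace M]
  (g : PseudoRiemannianMetric (𝓡 4) ∞ (EuclideanSpace ℝ (Fin 4)) (TangentSpace (𝓡 4) : M → Type _))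

/-! ### Reading the realised metric `ψ² g` on `g` -/

section Conformal

variable {g}
variable [g.HasLeviCivita] (hg : g.IsRiemannian)
  {g' : PseudoRiemannianMetric (𝓡 4) ∞ (EuclideanSpace ℝ (Fin 4)) (TangentSpace (𝓡 4) : M → Type _)}
  [g'.HasLeviCivita] (hg' : g'.IsRiemannian) {ψ : M → ℝ}
  (hψ : ContMDiff (𝓡 4) 𝓘(ℝ, ℝ) ∞ ψ) (hψpos : ∀ x, 0 < ψ x)
  (hval : ∀ (x : M) (v w : TangentSpace (𝓡 4) x), g'.val x v w = ψ x ^ 2 * g.val x v w)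
include hψ hψpos hval

omit [T2Space M] [SecondCountableTopology M] [g.HasLeviCivita] [g'.HasLeviCivita] hψpos in
/-- `∫ F dV_{ψ²g} = ∫ F ψ⁴ dV_g`. [cite: Aubin1982, Ch. 6, §6.3] -/
theorem integral_conformal (F : M → ℝ) :
    ∫ x, F x ∂(riemannianMeasure (g'.toContMDiffRiemannianMetric hg')) =
      ∫ x, F x * ψ x ^ 4 ∂(riemannianMeasure (g.toContMDiffRiemannianMetric hg)) := by
  set μ : Measure M := riemannianMeasure (g.toContMDiffRiemannianMetric hg) with hμ
  have hvol : riemannianMeasure (g'.toContMDiffRiemannianMetric hg') =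
      μ.withDensity fun x ↦ ENNReal.ofReal (ψ x ^ 4) :=
    riemannianMeasure_eq_withDensity_of_conformal_sq_four (g'.toContMDiffRiemannianMetric hg')
      (g.toContMDiffRiemannianMetric hg) hψ.continuous.measurable fun x v w ↦ by
        rw [PseudoRiemannianMetric.toContMDiffRiemannianMetric_inner,
          PseudoRiemannianMetric.toContMDiffRiemannianMetric_inner, hval]
  have hmeas : Measurable fun x ↦ ENNReal.ofReal (ψ x ^ 4) :=
    ENNReal.measurable_ofReal.comp (hψ.continuous.pow 4).measurable
  have hlt : ∀ᵐ x ∂μ, ENNReal.ofReal (ψ x ^ 4) < ⊤ := ae_of_all _ fun _ ↦ ENNReal.ofReal_lt_top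
  rw [hvol, integral_withDensity_eq_integral_toReal_smul hmeas hlt]
  refine integral_congr_ae (ae_of_all _ fun x ↦ ?_)
  dsimp only
  rw [ENNReal.toReal_ofReal (by positivity), smul_eq_mul, mul_comm]

omit [T2Space M] [SecondCountableTopology M] in
/-- **The `𝒲`-functional of `ψ² g` in `w²`-form, read on `g`**:
`∫ [τ(R' u² + 4|∇u|²') − u² log u² − 4u²] c dV' = ∫ [τ(ψ⁻³L_gψ u² + 4ψ⁻²|∇u|²_g) − u² log u² − 4u²] c ψ⁴ dV_g`.
[cite: Aubin1982, Ch. 6, §6.3] -/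
theorem functional_conformal (τ : ℝ) (u : M → ℝ) :
    ∫ x, (τ * (g'.scalarCurvature x * u x ^ 2 + 4 * g'.gradSq u x)
        - u x ^ 2 * Real.log (u x ^ 2) - 4 * u x ^ 2) * (4 * Real.pi * τ) ^ (-(4 : ℝ) / 2)
        ∂(riemannianMeasure (g'.toContMDiffRiemannianMetric hg')) =
      ∫ x, (τ * ((ψ x ^ 3)⁻¹ * (g.scalarCurvature x * ψ x - 6 * g.dalembertian ψ x) * (u x) ^ 2
          + 4 * ((ψ x)⁻¹ ^ 2 * g.gradSq u x))
        - (u x) ^ 2 * Real.log ((u x) ^ 2) - 4 * (u x) ^ 2)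
        * ((4 * Real.pi * τ) ^ (-(4 : ℝ) / 2) * (ψ x) ^ 4)
        ∂(riemannianMeasure (g.toContMDiffRiemannianMetric hg)) := by
  have hE : Module.finrank ℝ (EuclideanSpace ℝ (Fin 4)) = 4 := finrank_euclideanSpace_fin
  have hR : ∀ x, g'.scalarCurvature x =
      (ψ x ^ 3)⁻¹ * (g.scalarCurvature x * ψ x - 6 * g.dalembertian ψ x) :=
    PseudoRiemannianMetric.scalarCurvature_conformal_sq_four hE g g' hψ hψpos hval
  have hgrad : ∀ (f : M → ℝ) (x : M), g'.gradSq f x = (ψ x ^ 2)⁻¹ * g.gradSq f x := fun f x ↦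
    ConformalRealisation.gradSq_of_conformal g g' (φ := fun y ↦ ψ y ^ 2) hval
      (pow_pos (hψpos x) 2).ne' f
  rw [integral_conformal hg hg' hψ hval]
  refine integral_congr_ae (ae_of_all _ fun x ↦ ?_)
  have hψx : ψ x ≠ 0 := (hψpos x).ne'
  dsimp only
  rw [hR x, hgrad u x]
  field_simp

omit [T2Space M] [SecondCountableTopology M] [g.HasLeviCivita] [g'.HasLeviCivita] in
/-- The cut-off gradient cost of `ψ² g` read on `g`:
`∫ c u² (|∇χ₁|²' + |∇χ₂|²') dV' = ∫ c u² ψ² (|∇χ₁|²_g + |∇χ₂|²_g) dV_g`. [cite: Aubin1982, Ch. 6, §6.3] -/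
theorem cost_conformal (c : ℝ) (u χ₁ χ₂ : M → ℝ) :
    ∫ x, c * u x ^ 2 * (g'.gradSq χ₁ x + g'.gradSq χ₂ x)
        ∂(riemannianMeasure (g'.toContMDiffRiemannianMetric hg')) =
      ∫ x, c * (u x) ^ 2 * (ψ x) ^ 2 * (g.gradSq χ₁ x + g.gradSq χ₂ x)
        ∂(riemannianMeasure (g.toContMDiffRiemannianMetric hg)) := by
  have hgrad : ∀ (f : M → ℝ) (x : M), g'.gradSq f x = (ψ x ^ 2)⁻¹ * g.gradSq f x := fun f x ↦
    ConformalRealisation.gradSq_of_conformal g g' (φ := fun y ↦ ψ y ^ 2) hval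
      (pow_pos (hψpos x) 2).ne' f
  rw [integral_conformal hg hg' hψ hval]
  refine integral_congr_ae (ae_of_all _ fun x ↦ ?_)
  have hψx : ψ x ≠ 0 := (hψpos x).ne'
  dsimp only
  rw [hgrad χ₁ x, hgrad χ₂ x]
  field_simp

end Conformal

/-! ### Scaling of the un-normalised weighted functional -/

omit [T2Space M] [SecondCountableTopology M] in
/-- **Normalising a piece.** For the `ψ`-weighted functional in `w²`-form and a smooth `u` of mass
`m = ∫ c u² ψ⁴ dV > 0`, the function `û = m^{-1/2} u` is normalised and
`E_un(u) + m log m = m · E(û)`; hence a clause `E(û) ≥ L` gives `E_un(u) + m log m ≥ m L`. [folklore] -/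
theorem piece_ge_of_clause [g.HasLeviCivita] (hg : g.IsRiemannian) {τ : ℝ} (hτ : 0 < τ)
    {ψ r : M → ℝ} (hψ : ContMDiff (𝓡 4) 𝓘(ℝ, ℝ) ∞ ψ) (hψpos : ∀ x, 0 < ψ x) (hr : Continuous r)
    (hr0 : ∀ x, 0 ≤ r x) {U : Set M} {L : ℝ}
    (hclause : ∀ v : M → ℝ, ContMDiff (𝓡 4) 𝓘(ℝ, ℝ) ∞ v → tsupport v ⊆ U →
      ∫ x, (4 * Real.pi * τ) ^ (-(4 : ℝ) / 2) * (v x) ^ 2 * (ψ x) ^ 4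
          ∂(riemannianMeasure (g.toContMDiffRiemannianMetric hg)) = 1 →
        L ≤ ∫ x, (τ * (r x * (v x) ^ 2 + 4 * ((ψ x)⁻¹ ^ 2 * g.gradSq v x))
            - (v x) ^ 2 * Real.log ((v x) ^ 2) - 4 * (v x) ^ 2)
            * ((4 * Real.pi * τ) ^ (-(4 : ℝ) / 2) * (ψ x) ^ 4)
          ∂(riemannianMeasure (g.toContMDiffRiemannianMetric hg)))
    {u : M → ℝ} (hu : ContMDiff (𝓡 4) 𝓘(ℝ, ℝ) ∞ u) (hsupp : tsupport u ⊆ U) :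
    (∫ x, (4 * Real.pi * τ) ^ (-(4 : ℝ) / 2) * (u x) ^ 2 * (ψ x) ^ 4
        ∂(riemannianMeasure (g.toContMDiffRiemannianMetric hg))) * L ≤
      (∫ x, (τ * (r x * (u x) ^ 2 + 4 * ((ψ x)⁻¹ ^ 2 * g.gradSq u x))
          - (u x) ^ 2 * Real.log ((u x) ^ 2) - 4 * (u x) ^ 2)
          * ((4 * Real.pi * τ) ^ (-(4 : ℝ) / 2) * (ψ x) ^ 4)
        ∂(riemannianMeasure (g.toContMDiffRiemannianMetric hg))) +
      (∫ x, (4 * Real.pi * τ) ^ (-(4 : ℝ) / 2) * (u x) ^ 2 * (ψ x) ^ 4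
          ∂(riemannianMeasure (g.toContMDiffRiemannianMetric hg))) *
        Real.log (∫ x, (4 * Real.pi * τ) ^ (-(4 : ℝ) / 2) * (u x) ^ 2 * (ψ x) ^ 4
          ∂(riemannianMeasure (g.toContMDiffRiemannianMetric hg))) := by
  set μ : Measure M := riemannianMeasure (g.toContMDiffRiemannianMetric hg) with hμ
  set c : ℝ := (4 * Real.pi * τ) ^ (-(4 : ℝ) / 2) with hc
  have hcpos : 0 < c := Real.rpow_pos_of_pos (by positivity) _
  set m : ℝ := ∫ x, c * (u x) ^ 2 * (ψ x) ^ 4 ∂μ with hm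
  -- continuity / integrability of the pieces
  have huc : Continuous u := hu.continuous
  have hψc : Continuous ψ := hψ.continuous
  have hψinv : Continuous fun x ↦ (ψ x)⁻¹ := hψc.inv₀ fun x ↦ (hψpos x).ne'
  have hGu : Continuous (g.gradSq u) := (Literature.Geometry.Riemannian.contMDiff_gradSq g hu).continuous
  have hquad : Continuous fun x ↦ (r x * (u x) ^ 2 + 4 * ((ψ x)⁻¹ ^ 2 * g.gradSq u x)) * (c * (ψ x) ^ 4) :=
    ((hr.mul (huc.pow 2)).add (continuous_const.mul ((hψinv.pow 2).mul hGu))).mul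
      (continuous_const.mul (hψc.pow 4))
  have hul : Continuous fun x ↦ (u x) ^ 2 * Real.log ((u x) ^ 2) := Real.continuous_mul_log.comp (huc.pow 2)
  have iQ : Integrable (fun x ↦ (r x * (u x) ^ 2 + 4 * ((ψ x)⁻¹ ^ 2 * g.gradSq u x)) * (c * (ψ x) ^ 4)) μ :=
    EntropyLocalisation.integrable_of_continuous g hg hquad
  have iL : Integrable (fun x ↦ (u x) ^ 2 * Real.log ((u x) ^ 2) * (c * (ψ x) ^ 4)) μ :=
    EntropyLocalisation.integrable_of_continuous g hg (hul.mul (continuous_const.mul (hψc.pow 4)))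
  have iN : Integrable (fun x ↦ c * (u x) ^ 2 * (ψ x) ^ 4) μ :=
    EntropyLocalisation.integrable_of_continuous g hg ((continuous_const.mul (huc.pow 2)).mul (hψc.pow 4))
  have hm0 : 0 ≤ m := integral_nonneg fun x ↦ by positivity
  -- decomposition `E_un(u) = τ Q(u) − Ent(u) − 4 m`
  set Q : ℝ := ∫ x, (r x * (u x) ^ 2 + 4 * ((ψ x)⁻¹ ^ 2 * g.gradSq u x)) * (c * (ψ x) ^ 4) ∂μ with hQ
  set Ent : ℝ := ∫ x, (u x) ^ 2 * Real.log ((u x) ^ 2) * (c * (ψ x) ^ 4) ∂μ with hEnt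
  have hsplit : ∀ (s : ℝ) (v : M → ℝ), (∀ x, v x = s * u x) →
      ∫ x, (τ * (r x * (v x) ^ 2 + 4 * ((ψ x)⁻¹ ^ 2 * g.gradSq v x))
          - (v x) ^ 2 * Real.log ((v x) ^ 2) - 4 * (v x) ^ 2) * (c * (ψ x) ^ 4) ∂μ =
        s ^ 2 * (τ * Q - Ent - 4 * m) - s ^ 2 * Real.log (s ^ 2) * m := by
    intro s v hv
    have hveq : v = fun x ↦ s * u x := funext hv
    have hgradv : ∀ x, g.gradSq v x = s ^ 2 * g.gradSq u x := by
      intro x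
      have hux : MDifferentiableAt (𝓡 4) 𝓘(ℝ, ℝ) u x := (hu x).mdifferentiableAt (by simp)
      have hh : HasDerivAt (fun t : ℝ ↦ s * t) s (u x) := by simpa using (hasDerivAt_id (u x)).const_mul s
      rw [hveq, show (fun x ↦ s * u x) = (fun t : ℝ ↦ s * t) ∘ u from rfl, g.gradSq_real_comp hh hux]
    have hlog : ∀ x, (v x) ^ 2 * Real.log ((v x) ^ 2) =
        s ^ 2 * ((u x) ^ 2 * Real.log ((u x) ^ 2)) + s ^ 2 * Real.log (s ^ 2) * (u x) ^ 2 := by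
      intro x
      rw [hv x, mul_pow]
      rcases eq_or_ne (u x) 0 with hu0 | hu0
      · simp [hu0]
      rcases eq_or_ne s 0 with hs0 | hs0
      · simp [hs0]
      rw [Real.log_mul (pow_ne_zero 2 hs0) (pow_ne_zero 2 hu0)]
      ring
    have hpt : (fun x ↦ (τ * (r x * (v x) ^ 2 + 4 * ((ψ x)⁻¹ ^ 2 * g.gradSq v x))
        - (v x) ^ 2 * Real.log ((v x) ^ 2) - 4 * (v x) ^ 2) * (c * (ψ x) ^ 4)) = fun x ↦
        s ^ 2 * (τ * ((r x * (u x) ^ 2 + 4 * ((ψ x)⁻¹ ^ 2 * g.gradSq u x)) * (c * (ψ x) ^ 4)))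
        - s ^ 2 * ((u x) ^ 2 * Real.log ((u x) ^ 2) * (c * (ψ x) ^ 4))
        - (4 * s ^ 2 + s ^ 2 * Real.log (s ^ 2)) * (c * (u x) ^ 2 * (ψ x) ^ 4) := by
      funext x
      rw [hgradv x, hlog x, hv x]
      ring
    have i1 : Integrable (fun x ↦ s ^ 2 * (τ * ((r x * (u x) ^ 2 + 4 * ((ψ x)⁻¹ ^ 2 * g.gradSq u x))
        * (c * (ψ x) ^ 4)))) μ := (iQ.const_mul τ).const_mul _
    have i2 : Integrable (fun x ↦ s ^ 2 * ((u x) ^ 2 * Real.log ((u x) ^ 2) * (c * (ψ x) ^ 4))) μ :=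
      iL.const_mul _
    have i3 : Integrable (fun x ↦ (4 * s ^ 2 + s ^ 2 * Real.log (s ^ 2)) * (c * (u x) ^ 2 * (ψ x) ^ 4)) μ :=
      iN.const_mul _
    have i12 : Integrable (fun x ↦ s ^ 2 * (τ * ((r x * (u x) ^ 2 + 4 * ((ψ x)⁻¹ ^ 2 * g.gradSq u x))
        * (c * (ψ x) ^ 4))) - s ^ 2 * ((u x) ^ 2 * Real.log ((u x) ^ 2) * (c * (ψ x) ^ 4))) μ := i1.sub i2
    rw [hpt, integral_sub i12 i3, integral_sub i1 i2, integral_const_mul, integral_const_mul,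
      integral_const_mul, integral_const_mul]
    ring
  -- the case `m = 0`: the functional of `u` is `≥ 0 = m L − m log m`
  rcases hm0.eq_or_lt with hm00 | hmpos
  · rw [← hm00]
    simp only [zero_mul, Real.log_zero, mul_zero, add_zero]
    -- `u² ψ⁴ = 0` a.e., hence `u = 0` a.e.
    have hae : (fun x ↦ c * (u x) ^ 2 * (ψ x) ^ 4) =ᵐ[μ] 0 :=
      (integral_eq_zero_iff_of_nonneg (fun x ↦ by positivity) iN).1 hm00.symm
    have hu0 : ∀ᵐ x ∂μ, u x = 0 := by
      filter_upwards [hae] with x hx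
      have hx' : c * (u x) ^ 2 * (ψ x) ^ 4 = 0 := hx
      have hψ4 : (ψ x) ^ 4 ≠ 0 := pow_ne_zero 4 (hψpos x).ne'
      have h2 : (u x) ^ 2 = 0 := by
        rcases mul_eq_zero.1 hx' with h | h
        · rcases mul_eq_zero.1 h with h' | h'
          · exact absurd h' hcpos.ne'
          · exact h'
        · exact absurd h hψ4
      exact pow_eq_zero_iff (by norm_num) |>.1 h2
    have h1 := hsplit 1 u (fun x ↦ by ring)
    simp only [one_pow, one_mul, Real.log_one, zero_mul, sub_zero, mul_zero] at h1
    -- lower bound by the nonnegative quadratic part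
    have hlow : ∫ x, (τ * ((r x * (u x) ^ 2 + 4 * ((ψ x)⁻¹ ^ 2 * g.gradSq u x)) * (c * (ψ x) ^ 4))) ∂μ ≤
        ∫ x, (τ * (r x * (u x) ^ 2 + 4 * ((ψ x)⁻¹ ^ 2 * g.gradSq u x))
          - (u x) ^ 2 * Real.log ((u x) ^ 2) - 4 * (u x) ^ 2) * (c * (ψ x) ^ 4) ∂μ := by
      refine integral_mono_ae (iQ.const_mul τ) ?_ ?_
      · have : (fun x ↦ (τ * (r x * (u x) ^ 2 + 4 * ((ψ x)⁻¹ ^ 2 * g.gradSq u x))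
            - (u x) ^ 2 * Real.log ((u x) ^ 2) - 4 * (u x) ^ 2) * (c * (ψ x) ^ 4)) = fun x ↦
            τ * ((r x * (u x) ^ 2 + 4 * ((ψ x)⁻¹ ^ 2 * g.gradSq u x)) * (c * (ψ x) ^ 4))
            - (u x) ^ 2 * Real.log ((u x) ^ 2) * (c * (ψ x) ^ 4) - 4 * (c * (u x) ^ 2 * (ψ x) ^ 4) := by
          funext x; ring
        rw [this]
        exact ((iQ.const_mul τ).sub iL).sub (iN.const_mul 4)
      · filter_upwards [hu0] with x hx
        rw [hx]
        apply le_of_eq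
        ring
    have hQ0 : 0 ≤ ∫ x, (τ * ((r x * (u x) ^ 2 + 4 * ((ψ x)⁻¹ ^ 2 * g.gradSq u x)) * (c * (ψ x) ^ 4))) ∂μ :=
      integral_nonneg fun x ↦ by
        have := hr0 x; have := g.gradSq_nonneg hg u x; positivity
    linarith
  · -- `m > 0`: normalise
    set s : ℝ := (Real.sqrt m)⁻¹ with hs
    have hsq : s ^ 2 = m⁻¹ := by rw [hs, inv_pow, Real.sq_sqrt hmpos.le]
    have hspos : 0 < s := inv_pos.2 (Real.sqrt_pos.2 hmpos)
    set v : M → ℝ := fun x ↦ s * u x with hv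
    have hvs : ContMDiff (𝓡 4) 𝓘(ℝ, ℝ) ∞ v := contMDiff_const.mul hu
    have hvsupp : tsupport v ⊆ U := (tsupport_mul_subset_right.trans hsupp)
    have hvnorm : ∫ x, c * (v x) ^ 2 * (ψ x) ^ 4 ∂μ = 1 := by
      have : (fun x ↦ c * (v x) ^ 2 * (ψ x) ^ 4) = fun x ↦ s ^ 2 * (c * (u x) ^ 2 * (ψ x) ^ 4) := by
        funext x; simp only [hv]; ring
      rw [this, integral_const_mul, hsq, inv_mul_cancel₀ hmpos.ne']
    have hcl := hclause v hvs hvsupp hvnorm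
    have hE := hsplit s v (fun x ↦ rfl)
    rw [hE, hsq] at hcl
    -- `hcl : L ≤ m⁻¹ (τQ − Ent − 4m) − m⁻¹ log(m⁻¹) m`
    have h1 := hsplit 1 u (fun x ↦ by ring)
    simp only [one_pow, one_mul, Real.log_one, zero_mul, sub_zero, mul_zero] at h1
    rw [h1]
    rw [Real.log_inv] at hcl
    have hmul := mul_le_mul_of_nonneg_left hcl hmpos.le
    have hm1 : m * (m⁻¹ * (τ * Q - Ent - 4 * m) - m⁻¹ * -Real.log m * m) =
        (τ * Q - Ent - 4 * m) + m * Real.log m := by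
      field_simp
      ring
    linarith [hmul, hm1]

end GluingLocalisation

/-- **Normalising a localised piece** (registered sub-goal `gluingPieceClause` of Stub D of line
`green-blowup-conformal-entropy`; ∀-form of `GluingLocalisation.piece_ge_of_clause`): a clause at level
`L` for normalised test functions supported in `U` gives `m L ≤ E_un(u) + m log m` for every smooth `u`
supported in `U`, `m` its mass. [folklore] -/
theorem gluingPieceClause :
    ∀ (M : Type) [TopologicalSpace M] [T2Space M] [SecondCountableTopology M]
      [ChartedSpace (EuclideanSpace ℝ (Fin 4)) M] [IsManifold (𝓡 4) ∞ M] [CompactSpace M]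
      [T3Space M] [MeasurableSpace M] [BorelSpace M]
      (g : PseudoRiemannianMetric (𝓡 4) ∞ (EuclideanSpace ℝ (Fin 4)) (TangentSpace (𝓡 4) : M → Type _))
      [g.HasLeviCivita] (hg : g.IsRiemannian) (τ : ℝ), 0 < τ →
      ∀ (ψ r : M → ℝ), ContMDiff (𝓡 4) 𝓘(ℝ, ℝ) ∞ ψ → (∀ x, 0 < ψ x) → Continuous r → (∀ x, 0 ≤ r x) →
      ∀ (U : Set M) (L : ℝ),
      (∀ v : M → ℝ, ContMDiff (𝓡 4) 𝓘(ℝ, ℝ) ∞ v → tsupport v ⊆ U →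
        ∫ x, (4 * Real.pi * τ) ^ (-(4 : ℝ) / 2) * (v x) ^ 2 * (ψ x) ^ 4
            ∂(riemannianMeasure (g.toContMDiffRiemannianMetric hg)) = 1 →
          L ≤ ∫ x, (τ * (r x * (v x) ^ 2 + 4 * ((ψ x)⁻¹ ^ 2 * g.gradSq v x))
              - (v x) ^ 2 * Real.log ((v x) ^ 2) - 4 * (v x) ^ 2)
              * ((4 * Real.pi * τ) ^ (-(4 : ℝ) / 2) * (ψ x) ^ 4)
            ∂(riemannianMeasure (g.toContMDiffRiemannianMetric hg))) →
      ∀ (u : M → ℝ), ContMDiff (𝓡 4) 𝓘(ℝ, ℝ) ∞ u → tsupport u ⊆ U →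
        (∫ x, (4 * Real.pi * τ) ^ (-(4 : ℝ) / 2) * (u x) ^ 2 * (ψ x) ^ 4
            ∂(riemannianMeasure (g.toContMDiffRiemannianMetric hg))) * L ≤
          (∫ x, (τ * (r x * (u x) ^ 2 + 4 * ((ψ x)⁻¹ ^ 2 * g.gradSq u x))
              - (u x) ^ 2 * Real.log ((u x) ^ 2) - 4 * (u x) ^ 2)
              * ((4 * Real.pi * τ) ^ (-(4 : ℝ) / 2) * (ψ x) ^ 4)
            ∂(riemannianMeasure (g.toContMDiffRiemannianMetric hg))) +
          (∫ x, (4 * Real.pi * τ) ^ (-(4 : ℝ) / 2) * (u x) ^ 2 * (ψ x) ^ 4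
              ∂(riemannianMeasure (g.toContMDiffRiemannianMetric hg))) *
            Real.log (∫ x, (4 * Real.pi * τ) ^ (-(4 : ℝ) / 2) * (u x) ^ 2 * (ψ x) ^ 4
              ∂(riemannianMeasure (g.toContMDiffRiemannianMetric hg))) := by
  intro M _ _ _ _ _ _ _ _ _ g _ hg τ hτ ψ r hψ hψpos hr hr0 U L hclause u hu hsupp
  exact GluingLocalisation.piece_ge_of_clause g hg hτ hψ hψpos hr hr0 hclause hu hsupp

end Summit.SmoothPoincare4.SmoothPoincare4.Theorems

end
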